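import Summits.CriticalPhenomena.PercolationContinuityZ3.Theorems.Transplant.CayleyNilTwoQuotients
import Summits.CriticalPhenomena.PercolationContinuityZ3.Theorems.Transplant.CayleyClassTwoUnitRange
import HarnessLib

/-!
# Every 2-step nilpotent group `N_{m+2,2} ⧸ K` with EVERY inversion-stable unit-range alphabet: `θ(p_c) = 0`, unconditionally

builds on p205010 (kernel theorem, internal audit signed; external expert review pending) — through the closed one-type `{±1}` node and gen 13's
class-2 connected-cylinder theorem (`theta_eq_zero_of_le_classTwo`, file `CayleyClassTwoUnitRange`).  Lane `prim-bschramm`, seat `prim-bschramm-p4`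
gen 13 (PART C3 of `P4-GENERAL.md` §35.7).  Helper file (`--supports stmt-CriticalPhenomena-4575 --as helper`).

Gen 12's `FreeNilClass.TwoQuot.theta_eq_zero_of_le` (p336405) is the LETTERS-ONLY row of the central quotients `N_{m+2,2} ⧸ K` (`K ≤ γ₂`; = every
2-step nilpotent group with generators lifting a basis of a free abelianisation).  With the class-2 theorem the alphabet is free:
**`TwoQuot.theta_eq_zero_of_le_unitRange`: for every `m`, every `K ≤ γ₂(N_{m+2,2})` and EVERY finite symmetric generating `S ⊆ N_{m+2,2} ⧸ K` of unit
range under the letter chart `φQ = (x₀, x₁)` (exponent sums of `a₀, a₁`) containing two unit steps and stable under the descended letter inversion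
`νQ`, `θ_g(p) = 0` for all `p ≤ p_c` at every vertex of `Cay(N_{m+2,2} ⧸ K; S)`** — words of any length as generators (`a₀a₁`, `a₀a₂a₁⁻¹`,
`[a_i,a_j]·a₀`, …) as long as their `(x₀, x₁)`-heights are `≤ 1` and the alphabet is closed under `a_i ↦ a_i⁻¹` letterwise.  One line from
`theta_eq_zero_of_le_classTwo` with `TwoQuot.lcs_two_eq_bot`, `φQ_mul`, `νQ`, `φQ_νQ`; the letters-only row is the case `S = AQ K`
(`theta_eq_zero_of_le_letters'`).
[cite: BenjaminiSchramm1996, Conj. 4; §2 (Cayley graphs)] [cite: KozmaNitzan2024, §4 p. 16 (Lemma 8)]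
-/

noncomputable section

namespace Summit.CriticalPhenomena.PercolationContinuityZ3.Theorems.Transplant

open SimpleGraph Subgroup Literature.Probability.LatticeModels Literature.Probability.Percolation
open scoped commutatorElement Classical

namespace FreeNilClass

namespace TwoQuot

variable {m : ℕ} (K : Subgroup (N m 1)) [K.Normal] (hK : K ≤ (⊤ : Subgroup (N m 1)).lowerCentralSeries 1)

/-- **THEOREM (UNCONDITIONAL; every 2-step nilpotent central quotient, EVERY inversion-stable unit-range alphabet): `θ_g(p) = 0` for every
`p ≤ p_c` at every vertex of `Cay(N_{m+2,2} ⧸ K; S)`** for every finite symmetric generating `S` with `‖φQ(S)‖_∞ ≤ 1`, unit steps in `S` and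
`νQ(S) = S`. builds on p205010 (kernel theorem, internal audit signed; external expert review pending). [cite: BenjaminiSchramm1996, Conj. 4; §2] -/
theorem theta_eq_zero_of_le_unitRange (S : Finset (N m 1 ⧸ K)) (hsymm : ∀ s ∈ S, s⁻¹ ∈ S)
    (hgen : Subgroup.closure (S : Set (N m 1 ⧸ K)) = ⊤) (hr : ∀ s ∈ S, ∀ i : Fin 2, |φQ K hK s i| ≤ 1)
    (hstep : ∀ i : Fin 2, ∃ s ∈ S, φQ K hK s = Pi.single i 1) (hν : ∀ s, νQ K hK s ∈ S ↔ s ∈ S) (g : N m 1 ⧸ K) {p : unitInterval}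
    (hp : (p : ℝ) ≤ criticalProb (mulCayley (↑S : Set (N m 1 ⧸ K))) g) : theta (mulCayley (↑S : Set (N m 1 ⧸ K))) g p = 0 :=
  theta_eq_zero_of_le_classTwo (lcs_two_eq_bot K) (φQ K hK) (φQ_mul K hK) hr hstep hsymm hgen (νQ K hK) hν (φQ_νQ K hK) g hp

/-- **`θ_g(p_c) = 0` on `Cay(N_{m+2,2} ⧸ K; S)`** for every such alphabet (the `p = p_c` case).
builds on p205010 (kernel theorem, internal audit signed; external expert review pending). [cite: BenjaminiSchramm1996, Conj. 4; §2] -/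
theorem criticalContinuity_unitRange (S : Finset (N m 1 ⧸ K)) (hsymm : ∀ s ∈ S, s⁻¹ ∈ S)
    (hgen : Subgroup.closure (S : Set (N m 1 ⧸ K)) = ⊤) (hr : ∀ s ∈ S, ∀ i : Fin 2, |φQ K hK s i| ≤ 1)
    (hstep : ∀ i : Fin 2, ∃ s ∈ S, φQ K hK s = Pi.single i 1) (hν : ∀ s, νQ K hK s ∈ S ↔ s ∈ S) (g : N m 1 ⧸ K) :
    theta (mulCayley (↑S : Set (N m 1 ⧸ K))) g (criticalProbIOf (mulCayley (↑S : Set (N m 1 ⧸ K))) g) = 0 :=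
  theta_eq_zero_of_le_unitRange K hK S hsymm hgen hr hstep hν g le_rfl

include hK in
/-- Consistency: the letters-only alphabet `AQ K` satisfies the hypotheses, recovering gen 12's row through the class-2 theorem. [folklore] -/
theorem theta_eq_zero_of_le_letters' (g : N m 1 ⧸ K) {p : unitInterval}
    (hp : (p : ℝ) ≤ criticalProb (mulCayley (↑(AQ K) : Set (N m 1 ⧸ K))) g) : theta (mulCayley (↑(AQ K) : Set (N m 1 ⧸ K))) g p = 0 :=
  theta_eq_zero_of_le_unitRange K hK (AQ K) (fun _ => inv_mem_AQ K) (closure_AQ K) (fun _ hs => (negData K hK).lip_A hs)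
    (negData K hK).cayleyNeg₂.step (νQ_mem_AQ K hK) g hp

end TwoQuot

end FreeNilClass

end Summit.CriticalPhenomena.PercolationContinuityZ3.Theorems.Transplant

end
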